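import Summits.AtomisticToContinuum.Crystallization.Theorems.ExcessDecayLiouvilleLinearMassForm

/-!
# Route `ExcessDecayLiouville`: the CHAINED Caccioppoli levels (linear levels, IV)

Linear half of the harmonic-replacement architecture for item `ExcessDecay` (stmt-AtomisticToContinuum-9334).
With the local mass `M(f; X) = Σ'_p ‖f p‖² 𝟙[dist p c₀ ≤ X]`, the weighted far mass
`J_Y(f) = Σ'_q ‖f q‖² (max(dist q c₀, Y))⁻⁸` and the lattice difference `Δ_τ f = f(· + Aτ) − f`:

* `levelConst_le`, `harm_diff` : the level constant `L = (4C_a + 24C_J)/κ + 1`; differences of fields with zero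
  rows have zero rows (radius loss `2`);
* `mass_diff_le₁`, `mass_diff_le₂`, `mass_diff_le₃` : the chained levels for a field `g` with zero rows on
  `dist · c₀ ≤ ρ_g` and forward generators `e, e′, e″`:
  `M(Δ^j g; X) ≤ L^j X^{-2j} M(g; 4X+4 | 16X+20 | 64X+84) + {1, 7, 43}·L^j J_Y(g)`
  (`1 ≤ X`, `ρ_g ≥ 2X+2 | 8X+10 | 32X+42`, `25 ≤ Y ≤ 2X+2`).

All `[folklore]`; helper lemmas, nothing here closes an item.
-/

noncomputable section

namespace Summit.AtomisticToContinuum.Crystallization.Theorems.ExcessDecayLiouville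

open scoped BigOperators Topology InnerProductSpace RealInnerProductSpace Classical
open Literature.MathematicalPhysics.StatisticalMechanics
open Summit.AtomisticToContinuum.Crystallization.Theorems.PhononStabilityNegative

-- Local notation: the force-constant map `K(e)w = h(|e|²)w + 2⟪e,w⟫h′(|e|²)e`.
local notation3 "𝕂[" e "] " w:max =>
  (-((‖e‖ ^ 2)⁻¹) ^ 7 + ((‖e‖ ^ 2)⁻¹) ^ 4) • w + (2 * ⟪e, w⟫ * (7 * ((‖e‖ ^ 2)⁻¹) ^ 8 - 4 * ((‖e‖ ^ 2)⁻¹) ^ 5)) • e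
set_option quotPrecheck false in
local notation "𝟙ᵇ[" x ", " c ", " R "]" => (if dist (x : EuclideanSpace ℝ (Fin 3)) c ≤ R then (1 : ℝ) else 0)
set_option quotPrecheck false in
local notation "𝔣[" ρ ", " p ", " q "]" =>
  (if ρ < dist (p : EuclideanSpace ℝ (Fin 3)) q then (dist (p : EuclideanSpace ℝ (Fin 3)) q)⁻¹ ^ 8 else (0 : ℝ))
-- the three forward generators of `Λ₀`
local notation "𝐮₁" => (triangularVec₁ 1 : EuclideanSpace ℝ (Fin 3))
local notation "𝐮₂" => (triangularVec₂ 1 : EuclideanSpace ℝ (Fin 3))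
local notation "𝐰₃" => (layerNormal (2 * Real.sqrt (2 / 3)) : EuclideanSpace ℝ (Fin 3))
-- the constants of one level in mass form
local notation "Cₐ" => (19 * (1024 / ((23 / 25 : ℝ) ^ 3 * (23 / 25 : ℝ) ^ 3)) + 38 * (1024 / (23 / 25 : ℝ) ^ 3))
local notation "Cⱼ" => (9961472 : ℝ)

section

variable {t : Fin 2 → (EuclideanSpace ℝ (Fin 3))} {A : (EuclideanSpace ℝ (Fin 3)) →L[ℝ] (EuclideanSpace ℝ (Fin 3))}
  {c₀ : EuclideanSpace ℝ (Fin 3)} {κ : ℝ}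

set_option quotPrecheck false in
-- Local notation: the operator row `(L v)(p)`.
local notation "𝕃" v:max " @ " p:max =>
  tsum (fun q : Sites₀ t A => (if ((p : Sites₀ t A) : EuclideanSpace ℝ (Fin 3)) ≠ q then
    𝕂[((p : Sites₀ t A) : EuclideanSpace ℝ (Fin 3)) - q] (v ((p : Sites₀ t A) : EuclideanSpace ℝ (Fin 3)) - v q) else 0))
set_option quotPrecheck false in
-- local mass on the ball of radius `X` about the section centre `c₀`
local notation "𝐌[" f ", " X "]" =>
  tsum (fun p : Sites₀ t A => ‖f (p : EuclideanSpace ℝ (Fin 3))‖ ^ 2 * 𝟙ᵇ[p, c₀, X])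
set_option quotPrecheck false in
-- weighted far mass with floor `Y` about `c₀`
local notation "𝐉[" f ", " Y "]" =>
  tsum (fun q : Sites₀ t A => ‖f (q : EuclideanSpace ℝ (Fin 3))‖ ^ 2 * (max (dist (q : EuclideanSpace ℝ (Fin 3)) c₀) Y)⁻¹ ^ 8)
set_option quotPrecheck false in
-- lattice difference
local notation "Δ[" τ "] " f:max => (fun x : EuclideanSpace ℝ (Fin 3) => f (x + A τ) - f x)
set_option quotPrecheck false in
-- the level constant `L = (4Cₐ + 24Cⱼ)/κ + 1`
local notation "𝐋" => ((4 * Cₐ + 24 * Cⱼ) / κ + 1)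

/-! ## The chained levels for the forward generators -/

/-- The level constant: `1 ≤ L`, `4Cₐ/κ ≤ L`, `4Cⱼ/κ ≤ L`, `24Cⱼ/κ ≤ L`. [folklore] -/
theorem levelConst_le (hκ : 0 < κ) : 1 ≤ 𝐋 ∧ 4 * Cₐ / κ ≤ 𝐋 ∧ 4 * Cⱼ / κ ≤ 𝐋 ∧ 24 * Cⱼ / κ ≤ 𝐋 := by
  have hCa : (0 : ℝ) ≤ Cₐ := by positivity
  have h1 : 0 ≤ 4 * Cₐ / κ := by positivity
  have h2 : 0 ≤ 24 * Cⱼ / κ := by positivity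
  have h3 : 4 * Cⱼ / κ ≤ 24 * Cⱼ / κ := by gcongr; norm_num
  have hsplit : (4 * Cₐ + 24 * Cⱼ) / κ = 4 * Cₐ / κ + 24 * Cⱼ / κ := by rw [add_div]
  refine ⟨by linarith, by linarith, by linarith, by linarith⟩

/-- Differences of a field with zero operator rows on `dist · c₀ ≤ ρ_g` have zero rows on `dist · c₀ ≤ ρ_g − 2`
(generator version of `harm_translate_sub`). [folklore] -/
theorem harm_diff (hA : Adm₀ A) (hI : Inner₀ t A) {g : (EuclideanSpace ℝ (Fin 3)) → (EuclideanSpace ℝ (Fin 3))}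
    (hg : (Function.support g).Finite) {τ : EuclideanSpace ℝ (Fin 3)} (hτ : τ ∈ Λ₀) (hτ2 : ‖A τ‖ ≤ 2) {ρg : ℝ}
    (hharm : ∀ p : Sites₀ t A, dist (p : EuclideanSpace ℝ (Fin 3)) c₀ ≤ ρg → 𝕃 g @ p = 0) :
    ∀ p : Sites₀ t A, dist (p : EuclideanSpace ℝ (Fin 3)) c₀ ≤ ρg - 2 → 𝕃 (Δ[τ] g) @ p = 0 := by
  obtain ⟨B, hB⟩ := exists_norm_le_of_finite hg
  intro p hp
  exact harm_translate_sub hA hI hB hτ hτ2 (Gf := fun _ => 0) (fun _ => rfl) hharm p hp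

/-- **Chained level 1**: `M(Δ_e g; X) ≤ (L/X²) M(g; 4X+4) + L J_Y(g)` for a forward generator `e`, `g` finitely
supported with zero rows on `dist · c₀ ≤ ρ_g`, `1 ≤ X`, `2X+2 ≤ ρ_g`, `0 < Y ≤ 2X+2`. [folklore] -/
theorem mass_diff_le₁ (hA : Adm₀ A) (hI : Inner₀ t A) (hκ0 : 0 < κ)
    (hκ : ∀ v : (EuclideanSpace ℝ (Fin 3)) → (EuclideanSpace ℝ (Fin 3)), (Function.support v).Finite →
      Function.support v ⊆ Sites₀ t A → κ * nnForm t A v ≤ ∑' p : Sites₀ t A, ⟪𝕃 v @ p, v p⟫)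
    {g : (EuclideanSpace ℝ (Fin 3)) → (EuclideanSpace ℝ (Fin 3))} (hg : (Function.support g).Finite)
    {X : ℝ} (hX : 1 ≤ X) {ρg : ℝ} (hρg : 2 * X + 2 ≤ ρg)
    (hharm : ∀ p : Sites₀ t A, dist (p : EuclideanSpace ℝ (Fin 3)) c₀ ≤ ρg → 𝕃 g @ p = 0)
    {e : EuclideanSpace ℝ (Fin 3)} (he : e = 𝐮₁ ∨ e = 𝐮₂ ∨ e = 𝐰₃) {Y : ℝ} (hY : 0 < Y) (hYX : Y ≤ 2 * X + 2) :
    𝐌[Δ[e] g, X] ≤ 𝐋 / X ^ 2 * 𝐌[g, 4 * X + 4] + 𝐋 * 𝐉[g, Y] := by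
  obtain ⟨heΛ, he2⟩ := gen_mem hA he
  have key := mass_diff_le hA hI hκ0.le hκ hg hX hρg hharm heΛ he2 (Mτ := 4) (by norm_num) (dom_gen hA hI he) hY hYX
  obtain ⟨hL1, hLa, hLj, -⟩ := levelConst_le (κ := κ) hκ0
  have hM0 : 0 ≤ 𝐌[g, 4 * X + 4] := mass_nonneg g _
  have hJ0 : 0 ≤ 𝐉[g, Y] := farMass_nonneg g Y hY
  have hX2 : 0 < X ^ 2 := by positivity
  have h1 : 𝐌[Δ[e] g, X] ≤ (4 * (Cₐ / X ^ 2 * 𝐌[g, 4 * X + 4] + Cⱼ * 𝐉[g, Y])) / κ := by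
    rw [le_div_iff₀ hκ0, mul_comm]; exact key
  have h2 : (4 * (Cₐ / X ^ 2 * 𝐌[g, 4 * X + 4] + Cⱼ * 𝐉[g, Y])) / κ =
      (4 * Cₐ / κ) / X ^ 2 * 𝐌[g, 4 * X + 4] + (4 * Cⱼ / κ) * 𝐉[g, Y] := by ring
  rw [h2] at h1
  have h3 : (4 * Cₐ / κ) / X ^ 2 ≤ 𝐋 / X ^ 2 := div_le_div_of_nonneg_right hLa hX2.le
  calc 𝐌[Δ[e] g, X] ≤ (4 * Cₐ / κ) / X ^ 2 * 𝐌[g, 4 * X + 4] + (4 * Cⱼ / κ) * 𝐉[g, Y] := h1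
    _ ≤ 𝐋 / X ^ 2 * 𝐌[g, 4 * X + 4] + 𝐋 * 𝐉[g, Y] := by gcongr

/-- **Chained level 2**: `M(Δ_e Δ_{e'} g; X) ≤ (L²/X⁴) M(g; 16X+20) + 7 L² J_Y(g)` for forward generators
`e, e'`, `g` finitely supported with zero rows on `dist · c₀ ≤ ρ_g`, `1 ≤ X`, `8X+10 ≤ ρ_g`, `25 ≤ Y ≤ 2X+2`.
[folklore] -/
theorem mass_diff_le₂ (hA : Adm₀ A) (hI : Inner₀ t A) (hκ0 : 0 < κ)
    (hκ : ∀ v : (EuclideanSpace ℝ (Fin 3)) → (EuclideanSpace ℝ (Fin 3)), (Function.support v).Finite →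
      Function.support v ⊆ Sites₀ t A → κ * nnForm t A v ≤ ∑' p : Sites₀ t A, ⟪𝕃 v @ p, v p⟫)
    {g : (EuclideanSpace ℝ (Fin 3)) → (EuclideanSpace ℝ (Fin 3))} (hg : (Function.support g).Finite)
    {X : ℝ} (hX : 1 ≤ X) {ρg : ℝ} (hρg : 8 * X + 10 ≤ ρg)
    (hharm : ∀ p : Sites₀ t A, dist (p : EuclideanSpace ℝ (Fin 3)) c₀ ≤ ρg → 𝕃 g @ p = 0)
    {e e' : EuclideanSpace ℝ (Fin 3)} (he : e = 𝐮₁ ∨ e = 𝐮₂ ∨ e = 𝐰₃) (he' : e' = 𝐮₁ ∨ e' = 𝐮₂ ∨ e' = 𝐰₃)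
    {Y : ℝ} (hY : 25 ≤ Y) (hYX : Y ≤ 2 * X + 2) :
    𝐌[Δ[e] (Δ[e'] g), X] ≤ 𝐋 ^ 2 / X ^ 4 * 𝐌[g, 16 * X + 20] + 7 * 𝐋 ^ 2 * 𝐉[g, Y] := by
  obtain ⟨he'Λ, he'2⟩ := gen_mem hA he'
  have hY0 : 0 < Y := by linarith
  have hf : (Function.support (Δ[e'] g)).Finite := finite_support_translate_sub hg (A e')
  have hfharm := harm_diff hA hI hg he'Λ he'2 hharm
  have h1 := mass_diff_le₁ hA hI hκ0 hκ hf hX (ρg := ρg - 2) (by linarith) hfharm he hY0 hYX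
  have h2 := mass_diff_le₁ hA hI hκ0 hκ hg (X := 4 * X + 4) (by linarith) (ρg := ρg) (by linarith) hharm he' hY0
    (by linarith)
  have h3 := farMass_diff_le (t := t) (A := A) (c₀ := c₀) hg he'Λ he'2 hY
  obtain ⟨hL1, -, -, -⟩ := levelConst_le (κ := κ) hκ0
  have hL0 : 0 ≤ 𝐋 := by linarith
  have hM0 : 0 ≤ 𝐌[g, 16 * X + 20] := mass_nonneg g _
  have hJ0 : 0 ≤ 𝐉[g, Y] := farMass_nonneg g Y hY0
  have hX2 : 1 ≤ X ^ 2 := one_le_pow₀ hX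
  have hmono : 𝐌[g, 4 * (4 * X + 4) + 4] ≤ 𝐌[g, 16 * X + 20] := mass_mono hA hI g (by linarith)
  have hfrac : 𝐋 / (4 * X + 4) ^ 2 ≤ 𝐋 / X ^ 2 :=
    div_le_div_of_nonneg_left hL0 (by positivity) (pow_le_pow_left₀ (by linarith) (by linarith) 2)
  have hLX : 𝐋 / X ^ 2 ≤ 𝐋 := div_le_self hL0 hX2
  have hLX0 : 0 ≤ 𝐋 / X ^ 2 := by positivity
  calc 𝐌[Δ[e] (Δ[e'] g), X]
      ≤ 𝐋 / X ^ 2 * 𝐌[Δ[e'] g, 4 * X + 4] + 𝐋 * 𝐉[Δ[e'] g, Y] := h1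
    _ ≤ 𝐋 / X ^ 2 * (𝐋 / (4 * X + 4) ^ 2 * 𝐌[g, 4 * (4 * X + 4) + 4] + 𝐋 * 𝐉[g, Y]) + 𝐋 * (6 * 𝐉[g, Y]) := by
        gcongr
    _ ≤ 𝐋 / X ^ 2 * (𝐋 / X ^ 2 * 𝐌[g, 16 * X + 20] + 𝐋 * 𝐉[g, Y]) + 𝐋 * (6 * 𝐉[g, Y]) := by
        gcongr
    _ = 𝐋 ^ 2 / X ^ 4 * 𝐌[g, 16 * X + 20] + (𝐋 / X ^ 2 * 𝐋 + 6 * 𝐋) * 𝐉[g, Y] := by ring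
    _ ≤ 𝐋 ^ 2 / X ^ 4 * 𝐌[g, 16 * X + 20] + 7 * 𝐋 ^ 2 * 𝐉[g, Y] := by
        have : 𝐋 / X ^ 2 * 𝐋 + 6 * 𝐋 ≤ 7 * 𝐋 ^ 2 := by nlinarith
        nlinarith

/-- **Chained level 3**: `M(Δ_e Δ_{e'} Δ_{e''} g; X) ≤ (L³/X⁶) M(g; 64X+84) + 43 L³ J_Y(g)` for forward generators
`e, e', e''`, `g` finitely supported with zero rows on `dist · c₀ ≤ ρ_g`, `1 ≤ X`, `32X+42 ≤ ρ_g`,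
`25 ≤ Y ≤ 2X+2`. [folklore] -/
theorem mass_diff_le₃ (hA : Adm₀ A) (hI : Inner₀ t A) (hκ0 : 0 < κ)
    (hκ : ∀ v : (EuclideanSpace ℝ (Fin 3)) → (EuclideanSpace ℝ (Fin 3)), (Function.support v).Finite →
      Function.support v ⊆ Sites₀ t A → κ * nnForm t A v ≤ ∑' p : Sites₀ t A, ⟪𝕃 v @ p, v p⟫)
    {g : (EuclideanSpace ℝ (Fin 3)) → (EuclideanSpace ℝ (Fin 3))} (hg : (Function.support g).Finite)
    {X : ℝ} (hX : 1 ≤ X) {ρg : ℝ} (hρg : 32 * X + 42 ≤ ρg)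
    (hharm : ∀ p : Sites₀ t A, dist (p : EuclideanSpace ℝ (Fin 3)) c₀ ≤ ρg → 𝕃 g @ p = 0)
    {e e' e'' : EuclideanSpace ℝ (Fin 3)} (he : e = 𝐮₁ ∨ e = 𝐮₂ ∨ e = 𝐰₃) (he' : e' = 𝐮₁ ∨ e' = 𝐮₂ ∨ e' = 𝐰₃)
    (he'' : e'' = 𝐮₁ ∨ e'' = 𝐮₂ ∨ e'' = 𝐰₃) {Y : ℝ} (hY : 25 ≤ Y) (hYX : Y ≤ 2 * X + 2) :
    𝐌[Δ[e] (Δ[e'] (Δ[e''] g)), X] ≤ 𝐋 ^ 3 / X ^ 6 * 𝐌[g, 64 * X + 84] + 43 * 𝐋 ^ 3 * 𝐉[g, Y] := by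
  obtain ⟨he'Λ, he'2⟩ := gen_mem hA he'
  obtain ⟨he''Λ, he''2⟩ := gen_mem hA he''
  have hY0 : 0 < Y := by linarith
  have hf1 : (Function.support (Δ[e''] g)).Finite := finite_support_translate_sub hg (A e'')
  have hf2 : (Function.support (Δ[e'] (Δ[e''] g))).Finite := finite_support_translate_sub hf1 (A e')
  have hf1harm := harm_diff hA hI hg he''Λ he''2 hharm
  have hf2harm := harm_diff hA hI hf1 he'Λ he'2 hf1harm
  have h1 := mass_diff_le₁ hA hI hκ0 hκ hf2 hX (ρg := ρg - 2 - 2) (by linarith) hf2harm he hY0 hYX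
  have h2 := mass_diff_le₂ hA hI hκ0 hκ hg (X := 4 * X + 4) (by linarith) (ρg := ρg) (by linarith) hharm he' he'' hY
    (by linarith)
  have h3 : 𝐉[Δ[e'] (Δ[e''] g), Y] ≤ 36 * 𝐉[g, Y] :=
    calc 𝐉[Δ[e'] (Δ[e''] g), Y] ≤ 6 * 𝐉[Δ[e''] g, Y] := farMass_diff_le (t := t) (A := A) (c₀ := c₀) hf1 he'Λ he'2 hY
      _ ≤ 6 * (6 * 𝐉[g, Y]) := by gcongr; exact farMass_diff_le (t := t) (A := A) (c₀ := c₀) hg he''Λ he''2 hY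
      _ = 36 * 𝐉[g, Y] := by ring
  obtain ⟨hL1, -, -, -⟩ := levelConst_le (κ := κ) hκ0
  have hL0 : 0 ≤ 𝐋 := by linarith
  have hM0 : 0 ≤ 𝐌[g, 64 * X + 84] := mass_nonneg g _
  have hJ0 : 0 ≤ 𝐉[g, Y] := farMass_nonneg g Y hY0
  have hX2 : 1 ≤ X ^ 2 := one_le_pow₀ hX
  have hmono : 𝐌[g, 16 * (4 * X + 4) + 20] ≤ 𝐌[g, 64 * X + 84] := mass_mono hA hI g (by linarith)
  have hfrac : 𝐋 ^ 2 / (4 * X + 4) ^ 4 ≤ 𝐋 ^ 2 / X ^ 4 :=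
    div_le_div_of_nonneg_left (by positivity) (by positivity) (pow_le_pow_left₀ (by linarith) (by linarith) 4)
  have hLX : 𝐋 / X ^ 2 ≤ 𝐋 := div_le_self hL0 hX2
  have hLX0 : 0 ≤ 𝐋 / X ^ 2 := by positivity
  calc 𝐌[Δ[e] (Δ[e'] (Δ[e''] g)), X]
      ≤ 𝐋 / X ^ 2 * 𝐌[Δ[e'] (Δ[e''] g), 4 * X + 4] + 𝐋 * 𝐉[Δ[e'] (Δ[e''] g), Y] := h1
    _ ≤ 𝐋 / X ^ 2 * (𝐋 ^ 2 / (4 * X + 4) ^ 4 * 𝐌[g, 16 * (4 * X + 4) + 20] + 7 * 𝐋 ^ 2 * 𝐉[g, Y]) +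
        𝐋 * (36 * 𝐉[g, Y]) := by
        gcongr
    _ ≤ 𝐋 / X ^ 2 * (𝐋 ^ 2 / X ^ 4 * 𝐌[g, 64 * X + 84] + 7 * 𝐋 ^ 2 * 𝐉[g, Y]) + 𝐋 * (36 * 𝐉[g, Y]) := by
        gcongr
    _ = 𝐋 ^ 3 / X ^ 6 * 𝐌[g, 64 * X + 84] + (𝐋 / X ^ 2 * (7 * 𝐋 ^ 2) + 36 * 𝐋) * 𝐉[g, Y] := by ring
    _ ≤ 𝐋 ^ 3 / X ^ 6 * 𝐌[g, 64 * X + 84] + 43 * 𝐋 ^ 3 * 𝐉[g, Y] := by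
        have hL2 : 𝐋 ≤ 𝐋 ^ 3 := by nlinarith
        have : 𝐋 / X ^ 2 * (7 * 𝐋 ^ 2) + 36 * 𝐋 ≤ 43 * 𝐋 ^ 3 := by nlinarith
        nlinarith

end

end Summit.AtomisticToContinuum.Crystallization.Theorems.ExcessDecayLiouville

end
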